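import Summits.QuantumFields.YangMills.Theorems.PoincareLipschitzTwoSidedOfConcentrationStep
import Summits.QuantumFields.YangMills.Theses.PoincareLipschitz
import HarnessLib

/-!
# Route `PoincareLipschitz` ∕ LINE 27 «MedianCentring» — helper T-7: THE MARKOV DIRECTION «(Q) ⟸ `MeanDeviationL`»
# (the Theorems-side twin of the Cruxes workfile `Cruxes/HistoryTailL/Lines/median_centring_markov.lean`, critic #320 price P2, ideator ym-r3-idea-2 g15)

`quantile_of_meanDeviation : PoincareLipschitz.MeanDeviationL → (Q)`: the 3/4-quantile statement (Q) — the text of LINE 27's one open registered stub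
`stub_quantileDeviation` of `Cruxes/HistoryTailL/Lines/median_centring.lean` VERBATIM — follows from the first-moment crux of record (stmt-QuantumFields-23083)
by Markov's inequality at the shifted profile `b₀∕16` (`θBal` is linear in `b₀`: `E f ≤ θ(b₀∕16)∕2 = θ∕32`, so `Gibbs_K{θ∕8 ≤ f} ≤ 1∕4`).

WHY (the book): the K2 display candidate v8 `historyTailL_of_facts_quantile (hK1) (hC) (hR) (hQ)` (LEAD ★w1-19936 g10, K-12, over this seat's
✓`historyTailL_of_expConcentration_quantile`) replaces v7's row `hM : MeanDeviationL` by `hQ : ⟨(Q)⟩`; this file certifies BY KERNEL, Theorems-side,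
that the new row is implied by the old one — `historyTailL_of_facts_quantile hK1 hC hR (quantile_of_meanDeviation hM)` re-derives v7 — so v8 is never a
stronger assumption than v7.  (Cruxes modules are not importable under `Theorems/`; proof ported from the workfile with attribution, names re-homed.)

Width seat ym3-torus-px10 g6 (cell ym3-torus, WIDTH COPY «width 10»), `--supports stmt-QuantumFields-23133`.  Nothing of (Q), `MeanDeviationL`, `HistoryTailL`
or the rung (R3 = YM₃ on T³; NOT d = 4, NOT infinite volume, NOT a mass gap, NOT Clay) is proved; the Yang–Mills mass gap is NOT proved.
[adapted from `Cruxes/HistoryTailL/Lines/median_centring_markov.lean` (ideator ym-r3-idea-2 g15 ∕ critic #320 P2)]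
-/

set_option autoImplicit false

namespace Summit.QuantumFields.YangMills.Theorems.PoincareLipschitz.MedianCentring

open MeasureTheory
open Literature.MathematicalPhysics.QuantumFieldTheory.Balaban1983to89
open Literature.MathematicalPhysics.QuantumFieldTheory.Balaban1983to89.T3ContinuumYM3Torus
open Literature.MathematicalPhysics.QuantumFieldTheory.Balaban1983to89.T3UnitScaleTilt
open Literature.MathematicalPhysics.QuantumFieldTheory.Balaban1983to89.T3UnitLawDensityEML (ℰp measurableE_ℰp)

/-- `θBal` is linear in the profile constant `b₀`: dividing `b₀` by `c` divides the threshold by `c`. [cite: Balaban1985UV3, (7) p.257] -/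
theorem θBal_profile_div (L : ℕ) (γ b₀ p₀ c : ℝ) (i : ℕ) :
    θBal L γ (b₀ / c) p₀ i = θBal L γ b₀ p₀ i / c := by
  unfold θBal B10.pFun
  ring

/-- ★ **THE MARKOV DIRECTION `MeanDeviationL → (Q)`.**  The conclusion is the text of LINE 27's registered stub `stub_quantileDeviation` verbatim: for every
`L`, `b₀ > 0`, `p₀ > 2` some `γ₁ ∈ (0,1]` gives `Gibbs_K{dist1(Ū^j(∂a)) ≤ θ(K−j)∕8} ≥ 3∕4` at all depths `1 ≤ j ≤ K − 2` — from the first-moment crux at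
profile `b₀∕16` and Markov's inequality.  [cite: Balaban1985UV3, (7) p.257 and (71) p.273] -/
theorem quantile_of_meanDeviation
    (hM : Summit.QuantumFields.YangMills.Theses.PoincareLipschitz.MeanDeviationL) :
    ∀ (L : ℕ) (b₀ p₀ : ℝ), 0 < b₀ → 2 < p₀ → ∃ γ₁ : ℝ, 0 < γ₁ ∧ γ₁ ≤ 1 ∧ ∀ (F : T3Family) (γ : ℝ), F.L = L → 0 < γ → γ ≤ γ₁ →
            ∀ (K j : ℕ), 1 ≤ j → j + 2 ≤ K → ∀ a : Plaq (F.P K) j,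
              3 / 4 ≤ (gibbsK F ℰp γ K).real {U : GaugeField (F.P K) 0 (Matrix.specialUnitaryGroup (Fin 2) ℂ) | GaugeGroup.dist1 (GaugeField.plaqHol (Averaging.iter (fun i' => BlockAveraging.blockAvg (P := F.P K) (j := i') ℰp) j U) a) ≤ θBal F.L γ b₀ p₀ (K - j) / 8} := by
  intro L b₀ p₀ hb₀ hp₀
  obtain ⟨γ₁, hγ₁, hγ₁1, H⟩ := hM L (b₀ / 16) p₀ (by positivity) hp₀
  refine ⟨γ₁, hγ₁, hγ₁1, ?_⟩
  intro F γ hFL hγ hγγ₁ K j hj hjK a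
  have hmean := H F γ hFL hγ hγγ₁ K j hj (by omega) a
  rw [θBal_profile_div] at hmean
  -- abbreviations
  set μ := gibbsK F ℰp γ K with hμ
  set θ := θBal F.L γ b₀ p₀ (K - j) with hθ
  haveI : IsProbabilityMeasure μ := isProbabilityMeasure_gibbsK F ℰp hγ.le K
  have hL1 : 1 ≤ F.L := le_of_lt F.hL.2
  have hθpos : 0 < θ :=
    T3MinimiserStabilityReduction.θBal_pos hL1 hγ (hγγ₁.trans hγ₁1) hb₀ p₀ (K - j)
  set f : GaugeField (F.P K) 0 (Matrix.specialUnitaryGroup (Fin 2) ℂ) → ℝ := fun U =>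
    GaugeGroup.dist1 (GaugeField.plaqHol (Averaging.iter (fun i' => BlockAveraging.blockAvg (P := F.P K) (j := i') ℰp) j U) a) with hf
  have hf_meas : Measurable f :=
    RegularGaugeGroup.measurable_dist1.comp ((Missing.measurable_plaqHol a).comp
      (T4Continuum.measurable_iter _ (F.avgMeasurable_of_measurableE ℰp measurableE_ℰp K) j))
  have hf_nn : 0 ≤ᵐ[μ] f := ae_of_all _ (fun U => GaugeGroup.dist1_nonneg _)
  have hf_bd : ∀ᵐ U ∂μ, ‖f U‖ ≤ (2 : ℝ) := ae_of_all _ (fun U => by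
    rw [Real.norm_eq_abs, abs_of_nonneg (GaugeGroup.dist1_nonneg _)]
    exact Literature.MathematicalPhysics.QuantumFieldTheory.Balaban1983to89.T4PairDerivBridge.dist1_le_two_specialUnitaryGroup _)
  have hf_int : Integrable f μ := Integrable.mono' (integrable_const (2 : ℝ)) hf_meas.aestronglyMeasurable hf_bd
  -- Markov at level θ/8
  have hmarkov : θ / 8 * μ.real {U | θ / 8 ≤ f U} ≤ ∫ U, f U ∂μ :=
    mul_meas_ge_le_integral_of_nonneg hf_nn hf_int (θ / 8)
  have hint : ∫ U, f U ∂μ ≤ θ / 16 / 2 := hmean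
  have h1 : μ.real {U | θ / 8 ≤ f U} ≤ 1 / 4 := by
    have h := hmarkov.trans hint
    by_contra hcon
    rw [not_le] at hcon
    nlinarith [hθpos, hcon, h]
  -- pass to the complement
  have hS : MeasurableSet {U | f U ≤ θ / 8} := measurableSet_le hf_meas measurable_const
  have hsub : {U | f U ≤ θ / 8}ᶜ ⊆ {U | θ / 8 ≤ f U} := by
    intro U hU
    simp only [Set.mem_compl_iff, Set.mem_setOf_eq, not_le] at hU
    exact hU.le
  have h2 : μ.real {U | f U ≤ θ / 8}ᶜ ≤ 1 / 4 := (measureReal_mono hsub).trans h1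
  have h3 : μ.real {U | f U ≤ θ / 8} + μ.real {U | f U ≤ θ / 8}ᶜ = 1 := by
    rw [measureReal_add_measureReal_compl hS, probReal_univ]
  have h4 : 3 / 4 ≤ μ.real {U | f U ≤ θ / 8} := by linarith
  simpa [hf, hθ, hμ] using h4

end Summit.QuantumFields.YangMills.Theorems.PoincareLipschitz.MedianCentring
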